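import Literature.NumberTheory.EllipticCurves.CongruentNumberEvenMonskySelmerBound
import HarnessLib

/-!
# Monsky's `2`-Selmer formula for `E_n`, `n = 2p₁⋯p_k`, `≥` half, I: the relations carried by a kernel vector of `M`

Companion ("lower bound") of `CongruentNumberEvenMonskySelmer{Local,Bound}.lean`, which prove
`#Sel⁽²⁾(E_n/ℚ) ≤ 2^{2+s(n)}`, `2^{s(n)} = #ker M`, `M = ( Aᵀ + D₂  D₋₁ ; D₂  A + D₂ )` Monsky's matrix
(appendix to Heath-Brown, Invent. Math. 118 (1994), even case, typescript p. 41: "one finds that `2^{s(D)}` is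
the size of the kernel of the matrix `M`", printed as "a sketch proof"). There a normalised Selmer class was sent
to its coordinate vector `(v_{pᵢ}(b); v_{pᵢ}(a)) ∈ ker M`. HERE the converse: for every `x = (β; α) ∈ ker M` the
pair `(a, b) = (∏ pᵢ^{αᵢ}, ε ∏ pᵢ^{βᵢ})`, `ε = ±1` chosen with `b ≡ 1 (mod 4)` (`candB`), has its class
`c(a, b) = twoDescentClass (a, b)` IN `Sel⁽²⁾(E_n/ℚ)`, normalised, with coordinates `x`:

* §1 FROM `Mx = 0`: the row relations (`rel_inr`, `rel_inl` — the second block row is the `I₀*` relation for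
  `a` at `pᵢ`, the first, after quadratic reciprocity `A + Aᵀ = D₋₁ + uᵀu`, the one for `b`) and the two
  SUMMED relations `Σ uⱼαⱼ = Σ wⱼβⱼ` (`sum_u_alpha_eq`: the column sums of `A` vanish) and
  `Σ wⱼαⱼ = (Σ uⱼ)·(Σ wⱼβⱼ)` (`sum_w_alpha_eq`: the row sums of `A` are `(|u|+1)u` by reciprocity) — the
  latter two are exactly the `2`-ADIC conditions, which is the content of the appendix's sentence "As before
  it suffices to consider `p`-adic solubility for the various primes `p ∣ D₀`" (Heath-Brown 1993, Lemma 2);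
* (the candidate pair `(∏pᵢ^{αᵢ}, candB β)`, its Selmer membership and the count are in the sequels
  `CongruentNumberEvenMonskySelmerKernel.lean` / `…Exact.lean`).

Pure `𝔽₂`-linear algebra on Monsky's matrix (theorems only); no named fact. Cell `bsd-monsky` (prover-B).

## References

* [HeathBrown1994SelmerCongruentII] D. R. Heath-Brown, Invent. Math. 118 (1994) 331–370, Appendix
  (P. Monsky): typescript p. 38 L24–L31, p. 39 L1–L41 (`A`, `D_j`, `A + Aᵀ = D₋₁ + uᵀu`, `c(A) = 0`,
  `r(A) = u` or `0`), p. 41 L1–L36 (even `D`).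
* [SilvermanAEC2009] J. H. Silverman, *The Arithmetic of Elliptic Curves*, 2nd ed., Prop. X.1.4, X.4.9.
-/

noncomputable section

open scoped Classical

open Literature.NumberTheory.EllipticCurves.HeathBrown1994
open Literature.NumberTheory.EllipticCurves.CongruentNumberEvenMonskySelmer
open Matrix

namespace Literature.NumberTheory.EllipticCurves

namespace CongruentNumberEvenMonskySelmerKernel

variable {k : ℕ} {p : Fin k → ℕ}

/-! ## §0 Bookkeeping in `ℤ/2` -/

/-- `2 = 0` in `ℤ/2`. [folklore] -/
private theorem two_eq_zero : (2 : ZMod 2) = 0 := by decide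

/-- `u·u = u` in `ℤ/2`. [folklore] -/
private theorem mul_self_zmod2 (u : ZMod 2) : u * u = u := by revert u; decide

/-- Swapping a double sum over `j ≠ i`. [folklore] -/
private theorem sum_erase_comm (f : Fin k → Fin k → ZMod 2) :
    ∑ i, ∑ j ∈ Finset.univ.erase i, f i j = ∑ j, ∑ i ∈ Finset.univ.erase j, f i j :=
  Finset.sum_comm' fun i j => by
    simp only [Finset.mem_univ, Finset.mem_erase, ne_eq, true_and, and_true]
    exact ⟨fun h => Ne.symm h, fun h => Ne.symm h⟩

/-! ## §1 The relations carried by a kernel vector of `M = ( Aᵀ + D₂  D₋₁ ; D₂  A + D₂ )` -/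

section Kernel

variable (hp : ∀ i, (p i).Prime) (hp2 : ∀ i, p i ≠ 2) (hinj : Function.Injective p)
variable {β α : Fin k → ZMod 2} (hx : monskyMatrixEven p *ᵥ Sum.elim β α = 0)
include hx

/-- **The second block row** (`D₂β + (A + D₂)α = 0`) at `i`:
`Σ_{j ≠ i} A_ij αⱼ = αᵢ (wᵢ + A_ii) + βᵢ wᵢ` — the `I₀*` relation for `a` at `pᵢ`.
[cite: HeathBrown1994SelmerCongruentII, Appendix (Monsky), typescript p. 41 L20–L36] -/
theorem rel_inr (i : Fin k) :
    ∑ j ∈ Finset.univ.erase i, addLegendreSym (p j) (p i) * α j =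
      α i * (addLegendreSym 2 (p i) + ∑ l ∈ Finset.univ.erase i, addLegendreSym (p l) (p i)) +
        β i * addLegendreSym 2 (p i) := by
  obtain ⟨-, E2⟩ := monskyMatrixEven_mulVec_apply (p := p) β α i
  rw [hx, Pi.zero_apply] at E2
  linear_combination -E2 - (α i * addLegendreSym 2 (p i) +
    α i * ∑ l ∈ Finset.univ.erase i, addLegendreSym (p l) (p i) + β i * addLegendreSym 2 (p i)) * two_eq_zero

omit hx in
include hp hp2 hinj in
/-- Quadratic reciprocity inside a row: `Σ_{j≠i} [pᵢ/pⱼ] yⱼ = Σ_{j≠i} A_ij yⱼ + uᵢ Σ_{j≠i} uⱼ yⱼ`.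
[cite: HeathBrown1994SelmerCongruentII, Appendix (Monsky), typescript p. 39 L37–L41] -/
theorem sum_transpose_eq (y : Fin k → ZMod 2) (i : Fin k) :
    ∑ j ∈ Finset.univ.erase i, addLegendreSym (p i) (p j) * y j =
      ∑ j ∈ Finset.univ.erase i, addLegendreSym (p j) (p i) * y j +
        addLegendreSym (-1) (p i) * ∑ j ∈ Finset.univ.erase i, addLegendreSym (-1) (p j) * y j := by
  rw [Finset.mul_sum, ← Finset.sum_add_distrib]
  exact Finset.sum_congr rfl fun j hj => by
    rw [addLegendreSym_swap (hp j) (hp i) (hp2 j) (hp2 i) (fun h => Finset.ne_of_mem_erase hj (hinj h))]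
    ring

include hp hp2 hinj in
/-- **The first block row** (`(Aᵀ + D₂)β + D₋₁α = 0`) at `i`, after quadratic reciprocity:
`S·uᵢ + Σ_{j ≠ i} A_ij βⱼ = αᵢ uᵢ + βᵢ (uᵢ + wᵢ + A_ii)` with `S = Σⱼ uⱼ βⱼ` — the `I₀*` relation for `b` at `pᵢ`.
[cite: HeathBrown1994SelmerCongruentII, Appendix (Monsky), typescript p. 41 L20–L36] -/
theorem rel_inl (i : Fin k) :
    (∑ j, addLegendreSym (-1) (p j) * β j) * addLegendreSym (-1) (p i) +
        ∑ j ∈ Finset.univ.erase i, addLegendreSym (p j) (p i) * β j =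
      α i * addLegendreSym (-1) (p i) +
        β i * (addLegendreSym (-1) (p i) + addLegendreSym 2 (p i) +
          ∑ l ∈ Finset.univ.erase i, addLegendreSym (p l) (p i)) := by
  obtain ⟨E1, -⟩ := monskyMatrixEven_mulVec_apply (p := p) β α i
  rw [hx, Pi.zero_apply] at E1
  have hQR := sum_transpose_eq hp hp2 hinj β i
  have hsplit := Finset.add_sum_erase Finset.univ (fun j => addLegendreSym (-1) (p j) * β j) (Finset.mem_univ i)
  have hDm := mul_self_zmod2 (addLegendreSym (-1) (p i))
  set u := addLegendreSym (-1) (p i)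
  set w := addLegendreSym 2 (p i)
  set Aii := ∑ l ∈ Finset.univ.erase i, addLegendreSym (p l) (p i)
  set SA := ∑ j ∈ Finset.univ.erase i, addLegendreSym (p j) (p i) * β j
  set ST := ∑ j ∈ Finset.univ.erase i, addLegendreSym (p i) (p j) * β j
  set SU := ∑ j ∈ Finset.univ.erase i, addLegendreSym (-1) (p j) * β j
  set S := ∑ j, addLegendreSym (-1) (p j) * β j
  linear_combination -E1 - hQR - u * hsplit + β i * hDm - (α i * u + β i * w + β i * Aii) * two_eq_zero

/-- **Summing the first block rows: `Σ uⱼ αⱼ = Σ wⱼ βⱼ`** (the column sums of `A` vanish, `c(A) = 0`).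
This and `sum_w_alpha_eq` are the `2`-adic conditions on the candidate pair.
[cite: HeathBrown1994SelmerCongruentII, Appendix (Monsky), typescript p. 39 L44 – p. 40 L1] -/
theorem sum_u_alpha_eq :
    ∑ j, addLegendreSym (-1) (p j) * α j = ∑ j, addLegendreSym 2 (p j) * β j := by
  have hsum : ∑ i, (monskyMatrixEven p *ᵥ Sum.elim β α) (Sum.inl i) = 0 := by
    rw [hx]; simp
  have hrows : ∀ i, (monskyMatrixEven p *ᵥ Sum.elim β α) (Sum.inl i) =
      (∑ l ∈ Finset.univ.erase i, addLegendreSym (p l) (p i)) * β i +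
        ∑ j ∈ Finset.univ.erase i, addLegendreSym (p i) (p j) * β j +
        addLegendreSym 2 (p i) * β i + addLegendreSym (-1) (p i) * α i :=
    fun i => (monskyMatrixEven_mulVec_apply (p := p) β α i).1
  simp only [hrows, Finset.sum_add_distrib] at hsum
  -- the double sum equals `Σ_j A_jj β_j`
  have hdouble : ∑ i, ∑ j ∈ Finset.univ.erase i, addLegendreSym (p i) (p j) * β j =
      ∑ j, (∑ l ∈ Finset.univ.erase j, addLegendreSym (p l) (p j)) * β j := by
    rw [sum_erase_comm]
    exact Finset.sum_congr rfl fun j _ => by rw [Finset.sum_mul]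
  rw [hdouble] at hsum
  set D := ∑ j, (∑ l ∈ Finset.univ.erase j, addLegendreSym (p l) (p j)) * β j
  have hcomm : ∑ i, addLegendreSym (-1) (p i) * α i = ∑ j, addLegendreSym (-1) (p j) * α j := rfl
  linear_combination hsum - D * two_eq_zero -
    (∑ j, addLegendreSym 2 (p j) * β j) * two_eq_zero

include hp hp2 hinj in
/-- **Summing the second block rows: `Σ wⱼ αⱼ = (Σ uⱼ)·(Σ wⱼ βⱼ)`** (the row sums of `A` are `(|u| + 1)·u` by
`A + Aᵀ = D₋₁ + uᵀu`). [cite: HeathBrown1994SelmerCongruentII, Appendix (Monsky), typescript p. 39 L37 – p. 40 L5] -/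
theorem sum_w_alpha_eq :
    ∑ j, addLegendreSym 2 (p j) * α j =
      (∑ j, addLegendreSym (-1) (p j)) * ∑ j, addLegendreSym 2 (p j) * β j := by
  have hsum : ∑ i, (monskyMatrixEven p *ᵥ Sum.elim β α) (Sum.inr i) = 0 := by
    rw [hx]; simp
  have hrows : ∀ i, (monskyMatrixEven p *ᵥ Sum.elim β α) (Sum.inr i) =
      addLegendreSym 2 (p i) * β i +
        ((∑ l ∈ Finset.univ.erase i, addLegendreSym (p l) (p i)) * α i +
          ∑ j ∈ Finset.univ.erase i, addLegendreSym (p j) (p i) * α j) +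
        addLegendreSym 2 (p i) * α i :=
    fun i => (monskyMatrixEven_mulVec_apply (p := p) β α i).2
  simp only [hrows, Finset.sum_add_distrib] at hsum
  -- the double sum `Σ_i Σ_{j≠i} A_ij α_j = Σ_j α_j Σ_{i≠j} A_ij`, and `Σ_{i≠j} A_ij = A_jj + u_j (U - u_j)` by QR
  have hdouble : ∑ i, ∑ j ∈ Finset.univ.erase i, addLegendreSym (p j) (p i) * α j =
      ∑ j, (∑ l ∈ Finset.univ.erase j, addLegendreSym (p l) (p j)) * α j +
        (∑ j, addLegendreSym (-1) (p j)) * ∑ j, addLegendreSym (-1) (p j) * α j +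
        ∑ j, addLegendreSym (-1) (p j) * α j := by
    rw [sum_erase_comm]
    have hinner : ∀ j, ∑ i ∈ Finset.univ.erase j, addLegendreSym (p j) (p i) * α j =
        (∑ l ∈ Finset.univ.erase j, addLegendreSym (p l) (p j)) * α j +
          (∑ l, addLegendreSym (-1) (p l)) * (addLegendreSym (-1) (p j) * α j) +
          addLegendreSym (-1) (p j) * α j := by
      intro j
      have hQR : ∑ i ∈ Finset.univ.erase j, addLegendreSym (p j) (p i) * α j =
          ∑ i ∈ Finset.univ.erase j, addLegendreSym (p i) (p j) * α j +
            addLegendreSym (-1) (p j) * α j * ∑ i ∈ Finset.univ.erase j, addLegendreSym (-1) (p i) := by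
        rw [Finset.mul_sum, ← Finset.sum_add_distrib]
        exact Finset.sum_congr rfl fun i hi => by
          rw [addLegendreSym_swap (hp i) (hp j) (hp2 i) (hp2 j) (fun h => Finset.ne_of_mem_erase hi (hinj h))]
          ring
      have hsplit := Finset.add_sum_erase Finset.univ (fun l => addLegendreSym (-1) (p l)) (Finset.mem_univ j)
      have hDm := mul_self_zmod2 (addLegendreSym (-1) (p j))
      rw [hQR, Finset.sum_mul]
      set U := ∑ l, addLegendreSym (-1) (p l)
      set Ue := ∑ i ∈ Finset.univ.erase j, addLegendreSym (-1) (p i)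
      linear_combination (addLegendreSym (-1) (p j) * α j) * hsplit - α j * hDm -
        (addLegendreSym (-1) (p j) * α j) * two_eq_zero
    simp only [hinner, Finset.sum_add_distrib, ← Finset.mul_sum]
  rw [hdouble] at hsum
  have hU := sum_u_alpha_eq hx
  set D := ∑ j, (∑ l ∈ Finset.univ.erase j, addLegendreSym (p l) (p j)) * α j
  set U := ∑ j, addLegendreSym (-1) (p j)
  set Ua := ∑ j, addLegendreSym (-1) (p j) * α j
  set Wb := ∑ j, addLegendreSym 2 (p j) * β j
  set Wa := ∑ j, addLegendreSym 2 (p j) * α j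
  linear_combination hsum - (U + 1) * hU - (U * Wb + Wb + D) * two_eq_zero

end Kernel


end CongruentNumberEvenMonskySelmerKernel

end Literature.NumberTheory.EllipticCurves

end
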